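import Literature.NumberTheory.Sieve.HeathBrownCubicUpperBoundProofs
import Literature.NumberTheory.Sieve.HeathBrownCubicTypeIHolds
import Literature.NumberTheory.Sieve.HeathBrownCubicLemma71A
import Literature.NumberTheory.Sieve.HeathBrownCubicApproxAssembly
import Literature.NumberTheory.Sieve.HeathBrownCubicFLAssembly
import HarnessLib

/-!
# Heath-Brown's quantitative theorem (2.2): (2.2) ⇔ (2.4), and the frontier of its proof

Pure-proof companion (no definitions, D-0014) of `HeathBrownCubicPrimes.lean`,
`HeathBrownCubicPrimesOutline.lean` and `HeathBrownCubicPrimesOutlineProofs.lean`, for the named fact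
`Literature.NumberTheory.Sieve.CubicPrimes.HeathBrown2001_primePairCount_asymptotic` — the Theorem of
D. R. Heath-Brown, *Primes represented by `x³ + 2y³`*, Acta Math. 186 (2001) 1–84, p. 2, in the
sequence form (2.2), p. 4:
`π(𝒜) = σ₀ η²X² (3 log X)^{−1} {1 + O((log log X)^{−1/6})}`, `η = (log X)^{−c}`.

The layers already in the tree reduce (2.2) to the convergence of the singular product (proved,
`HeathBrown2001_singularProduct_holds`), the prime ideal theorem (2.3) for `K = ℚ(2^{1/3})`
(proved, `HeathBrown2001_firstDegreePIT_holds`, from Landau's prime ideal theorem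
`Literature.NumberTheory.LFunctions.NumberField.primeIdealTheorem_holds`) and the sieve comparison
(2.4) (`HeathBrown2001_sieveComparison`; `HeathBrown2001_primePairCount_asymptotic_of_sieveComparison`),
and (2.4) further to Heath-Brown's Lemmas 3.5–3.10
(`CubicSieve.HeathBrown2001_primePairCount_asymptotic_of_lemmas`) with Lemma 3.6 supplied by the
corrected Lemma 7.1 (`CubicSieve.HeathBrown2001_lemma_3_6_of_lemma_7_1`). This file adds:

* `HeathBrown2001_sieveComparison_of_primePairCount_asymptotic`,
  `HeathBrown2001_primePairCount_asymptotic_iff_sieveComparison` — conversely (2.2) and (2.3) give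
  back (2.4): `π(𝒜) − κπ(ℬ) = (π(𝒜) − M) − κ(π(ℬ) − ηX³/log X)` with `κηX³/log X = M`
  exactly, the second bracket being `O(M/log X)` by (2.3), and the limit `σ₀` of the ordered
  partial products being unique. So the two named facts `HeathBrown2001_primePairCount_asymptotic`
  and `HeathBrown2001_sieveComparison` are EQUIVALENT — one node of the decomposition of
  parity.S18, not two; whichever is discharged first discharges the other.
* `HeathBrown2001_primePairCount_asymptotic_of_lemma_7_1` — **the current trust base of (2.2)**:
  Lemma 3.5, the corrected Lemma 7.1 (`CubicSieve.HeathBrown2001_lemma_7_1_normWeighted`),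
  Lemmas 3.7, 3.8, 3.9, 3.10 — each a printed lemma of the paper, vendored as a named fact in
  `HeathBrownCubicSieveDecomposition` / `HeathBrownCubicUpperBound` / `HeathBrownCubicTypeII`;
  everything else on the way (singular product, (2.3), the reduction (2.3) + (2.4) ⇒ (2.2),
  Lemma 3.4, the bookkeeping (3.15)/p. 21, Lemma 3.6 ⇐ Lemma 7.1) is proved in the tree.
  The discharge `HeathBrown2001_primePairCount_asymptotic_holds` is this theorem applied to the six
  `_holds` theorems once they exist (the parity.S18 analogue is
  `setOf_prime_cube_add_two_mul_cube_infinite_of_lemma_7_1`, `HeathBrownCubicUpperBoundProofs`).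

## References

* D. R. Heath-Brown, *Primes represented by `x³ + 2y³`*, Acta Math. 186 (2001) 1–84: Theorem
  (p. 2), §2 (2.2)–(2.4) pp. 4–5, §3 (3.15) and p. 21. [cite: HeathBrownActa2001, Theorem (p. 2)]

## Tree search

`lean search 'primePairCount_asymptotic_of_lemma_7_1|sieveComparison_of_primePairCount|primePairCount_asymptotic_iff'`:
no hits before this file. Used: `eventually_abs_normPrimeCount_sub_le`, `kappa_def`, `mainTerm`,
`mainTerm_pos` (`HeathBrownCubicPrimes(Outline)`), `HeathBrown2001_firstDegreePIT_holds`,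
`HeathBrown2001_primePairCount_asymptotic_of_sieveComparison` (`…OutlineProofs`),
`CubicSieve.HeathBrown2001_primePairCount_asymptotic_of_lemmas` (`…TypeIIProofs`),
`CubicSieve.HeathBrown2001_lemma_3_6_of_lemma_7_1` (`…UpperBoundProofs`),
`LFunctions.NumberField.primeIdealTheorem_holds` (`LFunctions/PrimeIdealTheoremProofs`).
-/

noncomputable section

open Filter Asymptotics Finset Topology

namespace Literature.NumberTheory.Sieve.CubicPrimes

/-! ### (2.2) ⇔ (2.4) -/

/-- **(2.4) from (2.2)** (converse of the reduction on p. 5, using (2.3)): if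
`π(𝒜) = M{1 + O((log log X)^{−1/6})}`, `M = σ₀η²X²/(3 log X)`, then for the (unique) limit `σ₀`
of the ordered partial products and `κ = σ₀η(3X)^{−1}`,
`π(𝒜) − κπ(ℬ) = (π(𝒜) − M) − κ(π(ℬ) − ηX³/log X) = O(η²X²(log X)^{−1}(log log X)^{−1/6})`,
because `κ ηX³/log X = M` exactly and `|π(ℬ) − ηX³/log X| ≤ 2ηX³/(log X)²` eventually by (2.3)
(`eventually_abs_normPrimeCount_sub_le`, fed with `HeathBrown2001_firstDegreePIT_holds`), while
`(log X)^{−1} ≤ (log log X)^{−1/6}`. [cite: HeathBrownActa2001, §2 pp. 4–5] -/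
theorem HeathBrown2001_sieveComparison_of_primePairCount_asymptotic
    (h : HeathBrown2001_primePairCount_asymptotic) : HeathBrown2001_sieveComparison := by
  obtain ⟨c, hc, σ₀, hσ₀, hlim, hO⟩ := h
  intro σ₁ hlim₁
  obtain rfl : σ₁ = σ₀ := tendsto_nhds_unique hlim₁ hlim
  refine ⟨c, hc, ?_⟩
  obtain ⟨C₁, hC₁⟩ := hO.bound
  have hB := eventually_abs_normPrimeCount_sub_le HeathBrown2001_firstDegreePIT_holds hc
  refine IsBigO.of_bound ((‖C₁‖ + 2) * σ₁ / 3) ?_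
  filter_upwards [hC₁, hB, eventually_ge_atTop (2 : ℝ),
    Real.tendsto_log_atTop.eventually (eventually_ge_atTop (1 : ℝ)),
    (Real.tendsto_log_atTop.comp Real.tendsto_log_atTop).eventually (eventually_ge_atTop (1 : ℝ))]
    with X hC₁X hBX hX2 hL1 hLL1
  set L := Real.log X with hL
  set η := L ^ (-c) with hη
  set ℓ := Real.log L ^ (-(1 / 6 : ℝ)) with hℓ
  have hLL1' : 1 ≤ Real.log L := by simpa [Function.comp_def] using hLL1
  have hX1 : 1 < X := by linarith
  have hLpos : 0 < L := by linarith
  have hη0 : 0 < η := Real.rpow_pos_of_pos hLpos _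
  have hℓ0 : 0 < ℓ := Real.rpow_pos_of_pos (by linarith) _
  have hM : 0 < mainTerm c σ₁ X := mainTerm_pos hσ₀ hX1
  have hMdef : mainTerm c σ₁ X = σ₁ * η ^ 2 * X ^ 2 / (3 * L) := rfl
  -- `1/L ≤ ℓ = (log L)^{-1/6}` since `(log L)^{1/6} ≤ log L ≤ L`
  have hLℓ : L⁻¹ ≤ ℓ := by
    rw [hℓ, Real.rpow_neg (by linarith)]
    refine inv_anti₀ (Real.rpow_pos_of_pos (by linarith) _) ?_
    calc Real.log L ^ (1 / 6 : ℝ) ≤ Real.log L ^ (1 : ℝ) :=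
          Real.rpow_le_rpow_of_exponent_le hLL1' (by norm_num)
      _ = Real.log L := Real.rpow_one _
      _ ≤ L := Real.log_le_self hLpos.le
  -- `M ℓ = (σ₀/3) · (η²X²/L · ℓ)`
  have hE1 : mainTerm c σ₁ X * ℓ = σ₁ / 3 * (η ^ 2 * X ^ 2 / L * ℓ) := by
    rw [hMdef]; field_simp
  have hE0 : 0 ≤ η ^ 2 * X ^ 2 / L * ℓ := by positivity
  have hMℓ : 0 ≤ mainTerm c σ₁ X * ℓ := (mul_pos hM hℓ0).le
  -- `κ · ηX³/L = M` and `κ · 2ηX³/L² = 2M/L`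
  have hκ : kappa σ₁ X η * (η * X ^ 3 / L) = mainTerm c σ₁ X := by
    rw [kappa_def, hMdef]; field_simp
  have hκ' : kappa σ₁ X η * (2 * (η * X ^ 3 / L ^ 2)) = 2 * mainTerm c σ₁ X * L⁻¹ := by
    rw [kappa_def, hMdef]; field_simp
  have hκ0 : 0 ≤ kappa σ₁ X η := by rw [kappa_def]; positivity
  -- decomposition `π(𝒜) − κπ(ℬ) = (π(𝒜) − M) − κ (π(ℬ) − ηX³/L)`
  have hdec : (primePairCount X η : ℝ) - kappa σ₁ X η * normPrimeCount X η =
      ((primePairCount X η : ℝ) - mainTerm c σ₁ X) -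
        kappa σ₁ X η * ((normPrimeCount X η : ℝ) - η * X ^ 3 / L) := by
    rw [mul_sub, hκ]; ring
  -- the two brackets
  have h1 : |(primePairCount X η : ℝ) - mainTerm c σ₁ X| ≤ ‖C₁‖ * (mainTerm c σ₁ X * ℓ) := by
    have h1' : |(primePairCount X η : ℝ) - mainTerm c σ₁ X| ≤ C₁ * (mainTerm c σ₁ X * ℓ) := by
      have := hC₁X
      rwa [Real.norm_eq_abs, Real.norm_of_nonneg hMℓ] at this
    exact h1'.trans (mul_le_mul_of_nonneg_right (Real.le_norm_self C₁) hMℓ)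
  have h2 : kappa σ₁ X η * |(normPrimeCount X η : ℝ) - η * X ^ 3 / L| ≤
      2 * mainTerm c σ₁ X * ℓ := by
    calc kappa σ₁ X η * |(normPrimeCount X η : ℝ) - η * X ^ 3 / L|
        ≤ kappa σ₁ X η * (2 * (η * X ^ 3 / L ^ 2)) := mul_le_mul_of_nonneg_left hBX hκ0
      _ = 2 * mainTerm c σ₁ X * L⁻¹ := hκ'
      _ ≤ 2 * mainTerm c σ₁ X * ℓ := mul_le_mul_of_nonneg_left hLℓ (by positivity)
  rw [Real.norm_eq_abs, hdec, Real.norm_of_nonneg hE0]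
  calc |((primePairCount X η : ℝ) - mainTerm c σ₁ X) -
          kappa σ₁ X η * ((normPrimeCount X η : ℝ) - η * X ^ 3 / L)|
      ≤ |(primePairCount X η : ℝ) - mainTerm c σ₁ X| +
          kappa σ₁ X η * |(normPrimeCount X η : ℝ) - η * X ^ 3 / L| := by
        refine (abs_sub _ _).trans (add_le_add le_rfl ?_)
        rw [abs_mul, abs_of_nonneg hκ0]
    _ ≤ ‖C₁‖ * (mainTerm c σ₁ X * ℓ) + 2 * mainTerm c σ₁ X * ℓ := add_le_add h1 h2
    _ = (‖C₁‖ + 2) * (mainTerm c σ₁ X * ℓ) := by ring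
    _ = (‖C₁‖ + 2) * σ₁ / 3 * (η ^ 2 * X ^ 2 / L * ℓ) := by rw [hE1]; ring

/-- **(2.2) ⇔ (2.4)**: given the singular product and the prime ideal theorem (both proved in the
tree), Heath-Brown's quantitative theorem `HeathBrown2001_primePairCount_asymptotic` and his sieve
comparison `HeathBrown2001_sieveComparison` are equivalent named facts.
[cite: HeathBrownActa2001, §2 pp. 4–5] -/
theorem HeathBrown2001_primePairCount_asymptotic_iff_sieveComparison :
    HeathBrown2001_primePairCount_asymptotic ↔ HeathBrown2001_sieveComparison :=
  ⟨HeathBrown2001_sieveComparison_of_primePairCount_asymptotic,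
    HeathBrown2001_primePairCount_asymptotic_of_sieveComparison⟩

/-! ### The frontier of the decomposition -/

/-- **Heath-Brown's quantitative theorem (2.2) from Lemma 3.5, the corrected Lemma 7.1 and
Lemmas 3.7, 3.8, 3.9, 3.10** — the trust base of `HeathBrown2001_primePairCount_asymptotic` after
this file: everything else on the way (singular product, prime ideal theorem (2.3), the reduction
(2.3) + (2.4) ⇒ (2.2), Lemma 3.4, the bookkeeping (3.15)/p. 21, Lemma 3.6 ⇐ Lemma 7.1) is proved in
the tree. `HeathBrown2001_primePairCount_asymptotic_holds` will be this theorem applied to the six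
discharges. [cite: HeathBrownActa2001, Theorem (p. 2)] -/
theorem HeathBrown2001_primePairCount_asymptotic_of_lemma_7_1
    (h35 : CubicSieve.HeathBrown2001_lemma_3_5)
    (h71 : CubicSieve.HeathBrown2001_lemma_7_1_normWeighted)
    (h37 : CubicSieve.HeathBrown2001_lemma_3_7) (h38 : CubicSieve.HeathBrown2001_lemma_3_8)
    (h39 : CubicSieve.HeathBrown2001_lemma_3_9) (h310 : CubicSieve.HeathBrown2001_lemma_3_10) :
    HeathBrown2001_primePairCount_asymptotic :=
  CubicSieve.HeathBrown2001_primePairCount_asymptotic_of_lemmas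
    Literature.NumberTheory.LFunctions.NumberField.primeIdealTheorem_holds h35
    (CubicSieve.HeathBrown2001_lemma_3_6_of_lemma_7_1 h71) h37 h38 h39 h310

end Literature.NumberTheory.Sieve.CubicPrimes

/-! ### Appended 2026-08-15: the frontier after Lemma 3.2 (`HeathBrown2001_typeI_A_holds`)

With the Type I bound Lemma 3.2 PROVED in the tree (`CubicSieve.HeathBrown2001_typeI_A_holds`,
`HeathBrownCubicTypeIHolds`), the corrected Lemma 7.1 (`HeathBrown2001_lemma_7_1_normWeighted_of_typeI_A`,
`HeathBrownCubicLemma71A`), Lemma 3.6 (`HeathBrown2001_lemma_3_6_of_typeI_A`) and Lemma 3.7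
(`HeathBrown2001_lemma_3_7_of_lemma_7_1`, `HeathBrownCubicApproxAssembly`) are discharged below, and the
trust base of `HeathBrown2001_primePairCount_asymptotic` shrinks to Lemma 3.5 (reduced in
`HeathBrownCubicFLAssembly` to Lemma 3.2 and a Mertens product for `K`), Lemma 3.8, Lemma 3.9 and
Lemma 3.10 (`HeathBrown2001_primePairCount_asymptotic_of_typeII`). -/

namespace Literature.NumberTheory.Sieve.CubicSieve

/-- **Heath-Brown's corrected Lemma 7.1 holds** (discharge of the named fact
`HeathBrown2001_lemma_7_1_normWeighted` of `HeathBrownCubicUpperBound`): the tree's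
`HeathBrown2001_lemma_7_1_normWeighted_of_typeI_A` applied to `HeathBrown2001_typeI_A_holds`.
[cite: HeathBrownActa2001, Lemma 7.1] -/
theorem HeathBrown2001_lemma_7_1_normWeighted_holds : HeathBrown2001_lemma_7_1_normWeighted :=
  HeathBrown2001_lemma_7_1_normWeighted_of_typeI_A HeathBrown2001_typeI_A_holds

/-- **Heath-Brown's Lemma 3.6 holds** (discharge of `HeathBrown2001_lemma_3_6` of
`HeathBrownCubicSieveDecomposition`): `HeathBrown2001_lemma_3_6_of_typeI_A` applied to
`HeathBrown2001_typeI_A_holds`. [cite: HeathBrownActa2001, Lemma 3.6] -/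
theorem HeathBrown2001_lemma_3_6_holds : HeathBrown2001_lemma_3_6 :=
  HeathBrown2001_lemma_3_6_of_typeI_A HeathBrown2001_typeI_A_holds

/-- **Heath-Brown's Lemma 3.7 holds** (discharge of `HeathBrown2001_lemma_3_7` of
`HeathBrownCubicTypeII`): `HeathBrown2001_lemma_3_7_of_lemma_7_1` (`HeathBrownCubicApproxAssembly`)
applied to `HeathBrown2001_lemma_7_1_normWeighted_holds`. [cite: HeathBrownActa2001, Lemma 3.7] -/
theorem HeathBrown2001_lemma_3_7_holds : HeathBrown2001_lemma_3_7 :=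
  HeathBrown2001_lemma_3_7_of_lemma_7_1 HeathBrown2001_lemma_7_1_normWeighted_holds

end Literature.NumberTheory.Sieve.CubicSieve

namespace Literature.NumberTheory.Sieve.CubicPrimes

/-- **Heath-Brown's quantitative theorem (2.2) from Lemmas 3.5, 3.8, 3.9, 3.10** — the trust base of
`HeathBrown2001_primePairCount_asymptotic` after the discharge of Lemma 3.2 (and with it of the
corrected Lemma 7.1, Lemma 3.6 and Lemma 3.7): `HeathBrown2001_primePairCount_asymptotic_of_lemma_7_1`
with `HeathBrown2001_lemma_7_1_normWeighted_holds` and `HeathBrown2001_lemma_3_7_holds` fed in.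
`HeathBrown2001_primePairCount_asymptotic_holds` will be this theorem applied to the four discharges.
[cite: HeathBrownActa2001, Theorem (p. 2)] -/
theorem HeathBrown2001_primePairCount_asymptotic_of_typeII
    (h35 : CubicSieve.HeathBrown2001_lemma_3_5) (h38 : CubicSieve.HeathBrown2001_lemma_3_8)
    (h39 : CubicSieve.HeathBrown2001_lemma_3_9) (h310 : CubicSieve.HeathBrown2001_lemma_3_10) :
    HeathBrown2001_primePairCount_asymptotic :=
  HeathBrown2001_primePairCount_asymptotic_of_lemma_7_1 h35
    CubicSieve.HeathBrown2001_lemma_7_1_normWeighted_holds CubicSieve.HeathBrown2001_lemma_3_7_holds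
    h38 h39 h310

/-- The same with Lemma 3.5 replaced by its remaining input, the Mertens product for the norm density
of `K` (`HeathBrownCubicFLAssembly.HeathBrown2001_lemma_3_5_of_typeI_A`; Lemma 3.2 is proved).
[cite: HeathBrownActa2001, Theorem (p. 2)] -/
theorem HeathBrown2001_primePairCount_asymptotic_of_mertens
    (hmer : ∃ C z₀ : ℝ, ∀ z : ℝ, z₀ ≤ z →
      |(∏ p ∈ Nat.primesBelow ⌈z⌉₊, (1 - CubicSieve.normDensityAt p)) *
          (Real.exp Real.eulerMascheroniConstant * CubicSieve.gamma₀ * Real.log z) - 1| ≤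
        C / Real.log z)
    (h38 : CubicSieve.HeathBrown2001_lemma_3_8) (h39 : CubicSieve.HeathBrown2001_lemma_3_9)
    (h310 : CubicSieve.HeathBrown2001_lemma_3_10) :
    HeathBrown2001_primePairCount_asymptotic :=
  HeathBrown2001_primePairCount_asymptotic_of_typeII
    (CubicSieve.HeathBrown2001_lemma_3_5_of_typeI_A CubicSieve.HeathBrown2001_typeI_A_holds hmer)
    h38 h39 h310

end Literature.NumberTheory.Sieve.CubicPrimes

end
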